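import Literature.MathematicalPhysics.QuantumFieldTheory.O2ThreeScalarCrossing
import Literature.MathematicalPhysics.QuantumFieldTheory.ConformalBootstrap3D.SigmaEpsilonSystem

/-!
# The `O(2)` three-scalar system `{s, φ, t}`: typed axioms, the windowed enclosure statement, and the
# reduction of box exclusion to point-functional positivity over genuine blocks
# (Chester–Landry–Liu–Poland–Simmons-Duffin–Su–Vichi, JHEP 06 (2020) 142, §2.1–§2.2, §3.1–§3.3)

Topic `MathematicalPhysics/QuantumFieldTheory`; definitions + elementary theorems only (no named fact, no
instance, no `sorry`).  The `O(2)` analogue of `ONArchipelagoSystem.lean` (the `O(N)` `{φ_i, s}` system)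
and of `ConformalBootstrap3D/SigmaEpsilonSystem.lean` (the `ℤ₂` `{σ, ε}` system): a statement-level typing of
the hypotheses under which the island of the cited paper in `(Δ_s, Δ_φ, Δ_t)` is derived, so that a
CERTIFIED exclusion can be stated as a theorem `O2Enclosure A W R` / `BoxExcluded A Q` about exactly these
hypotheses, together with the one theorem that turns a family of positive point functionals into
`BoxExcluded A Q` (`boxExcluded_of_pointFunctionals`).  Nothing here constructs a CFT, evaluates a block,
or asserts an island; the printed island `Δ_φ = 0.519088(22)`, `Δ_s = 1.51136(22)`, `Δ_t = 1.23629(11)` of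
the source is a floating-point `SDPB` result at `Λ = 43`, not an instance of these predicates.

THE ROWS are those of `O2ThreeScalarCrossing.lean`, quoted verbatim from the source's appendix «Crossing
vectors» (`V0p … V4`, 22 rows, over opaque channel functions of the cross-ratios `(u, v)`, one opaque family
`g : Label → ℝ → ℝ → ℝ` per exchanged primary; the quadratic forms `quad0p … quad2p`, the external form
`quadVext`, the unit `quad0p D 1 1 1 unitBlocks`, functionals `α`, `alphaMat`, `pointFunctional₂₂` and the
exclusion step `false_of_functional₂₂` are imported from there).  THIS file adds what that file lists under
"what is NOT here": the DATUM (`O2Data`: a hypothetical spectrum sector by sector, with dimensions and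
spins), the AXIOMS — A2 genuine blocks (`HasGenuineBlocks`), A1 unitarity bounds and spin parities
(`SatisfiesUnitarity`), A3 crossing as `HasSum` identities at every real point of the square `z, z̄ ∈ (0,1)`
(`SatisfiesCrossing`), A4 the spectral assumptions of §2.2, PARAMETRISED (`O2Gaps`, `SatisfiesGaps`) — the
enclosure notions, and the dual side.

SOURCE, §2.2 (held text `paper:arxiv-1912.03324`, pp. 7–8).  *"we impose that `s, φ, t` are the only
relevant scalars in their respective charge sectors.  In other words, we impose that `Δ ≥ 3` for all charge
`0, 1, 2` scalars after these operators.  We also forbid any possibility of degenerate scalar contributions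
at the scaling dimensions `Δ_{s,φ,t}`"*; *"we impose a much weaker bound of `Δ ≥ 1` for charge-3
scalars"*; *"in most of this work we will impose `Δ ≥ 3` for charge-4 scalars (following an initial study
which imposes the weaker condition `Δ ≥ 1`)"*; *"it is useful to impose a small gap `δ_τ` in twist
`τ = Δ − ℓ` above the unitarity bound for the non-scalar operators in the theory.  (The unitarity bound for
non-scalars is `τ ≥ 1`.)  Of course the spectrum must include the `O(2)` current `J^μ` and the stress tensor
`T^{μν}`, so we impose the twist gap only for operators with dimensions above the current and stress tensor
in their respective sectors … In most of this work, we choose `δ_τ = 10⁻⁶`.  Overall, our assumptions about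
the spectrum of the `O(2)` model are listed in table"* 2 (the table itself is not reproduced in the held
text; `O2Gaps` carries the five scalar thresholds and `δ_τ` as parameters, `chesterGaps` /
`chesterGapsInitial` record the quoted values, and `freeGaps` is "no assumption", implied by A1:
`satisfiesGaps_free`).  The twist clause is typed as read: every exchanged primary of spin `ℓ ≥ 1` has
`Δ ≥ ℓ + 1 + δ_τ`, except that `0⁻` primaries with `(ℓ, Δ) = (1, 2)` (the current) and `0⁺` primaries with
`(ℓ, Δ) = (2, 3)` (the stress tensor) are admitted.

SOURCE, §3.1 and §3.3 (the dual side, quoted in `O2ThreeScalarCrossing.lean`): a functional `α` with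
`α(V⃗_{0⁺}) ⪰ 0, α(V⃗_{0⁻}) ⪰ 0, α(V⃗_1) ⪰ 0, α(V⃗_{2⁺}) ⪰ 0, α(V⃗_{2⁻}) ≥ 0, α(V⃗_3) ≥ 0, α(V⃗_4) ≥ 0` *"for all
combinations of representations, dimensions `Δ`, and even or odd spins `ℓ` in some hypothetical spectrum"*,
unit normalisation, and for the externals the weaker condition `λ_extᵀ α(V⃗_ext) λ_ext ≥ 0` at the class
`[λ_ext] ∈ ℝP³`; *"If `α` exists for all `[λ_ext]`, then the point `(Δ_s, Δ_φ, Δ_t)` is disallowed."*  Here: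
`IsPositiveFor α A D l` is that list of conditions at external dimensions `D`, thresholds `A` and class
representative `l`, quantified over every `(Δ, ℓ)` the axioms A1 + A4 admit in each sector (`O2Gaps.Allows0p`
… `Allows4`) and over every GENUINE block family (A2) — the obligations a certificate discharges — and
`boxExcluded_of_pointFunctionals` is the quoted sentence for point functionals (finite combinations of
point evaluations at points of the square, for which termwise application to the sector series is automatic).

CONVENTIONS (the only delicate point, settled as in `ONArchipelagoSystem.lean`, module docstring (i)–(iii)).
(a) Blocks.  A2 uses the genuine 3D blocks `IsConformalBlock3D Δ₁₂ Δ₃₄ Δ ℓ` of the `σ–ε` file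
(`z`-coordinates, normalisation `c_ℓ = 1` uniformly in `(Δ₁₂, Δ₃₄)`), pulled back to functions of `(u, v)`
along `u = z z̄`, `v = (1−z)(1−z̄)` (`pullbackZ`, `IsBlockUV`; the imported `F^{ij,kl}_∓` at such a point IS the
`z`-coordinate `crossF`: `Fminus_pullbackZ`, `Fplus_pullbackZ`).  The source expands *"`Σ_𝒪 (−1)^ℓ λ_{12𝒪} λ_{34𝒪} …
g^{Δ₁₂,Δ₃₄}_{Δ,ℓ}(u,v)`"* with an EXPLICIT `(−1)^ℓ` and blocks *"normalized as in the second line of table 1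
in"* Poland–Rychkov–Vichi 2019, and its printed rows already carry the resulting signs `ε = (−1)^ℓ` on
exactly the families where the A2 convention puts them (sector `1`: on `F^{tφ,tφ}`, `F^{φs,φs}`, `F^{sφ,φt}`,
not on `F^{φt,tφ}`, `F^{sφ,φs}`, `F^{φs,φt}` — the placement verified for the `{φ, s}` rows against the
Kos–Poland–Simmons-Duffin–Vichi derivation in `O2ThreeScalarCrossing.quad1_kpsv` and explained in
`ONArchipelagoSystem.lean` (ii)); block normalisations differ between papers by POSITIVE factors depending
on the exchanged `(Δ, ℓ)` only, never on the label, so each exchanged primary's printed contribution is a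
positive multiple of the same expression over A2 blocks, absorbed into its real couplings.  (b) Externals.
The four couplings `λ_ext = (λ_{sss}, λ_{φφs}, λ_{tts}, λ_{φφt})` enter all three exchanged-external terms
(`quadVext`): permutation symmetry of scalar OPE coefficients is BUILT IN, meaningful because the A2 scalar
blocks have the `Δ`-independent leading coefficient `1` (`HasLeadingPart`), as the source's footnote *"OPE
coefficients of scalar operators are symmetric with respect to permutation"* requires of its own.
(c) Which labels.  A2 constrains a sector's block family only at the labels that sector's rows USE
(`labels0p … labels4`): demanding a genuine `g^{Δ₁₂,Δ₃₄}_{ℓ+1,ℓ}` with `Δ₁₂ Δ₃₄ ≠ 0` of the stress tensor,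
say, would make the axioms inconsistent (no such block exists, `IsConformalBlock3D` docstring).

WHAT THE AXIOMS DO NOT SAY (deliberately).  The Ward identities expressing `λ_{𝒪𝒪T}`, `λ_{𝒪𝒪J}` through
`C_T`, `C_J` (§2.2 end; needed only for the `C_T, C_J` bounds of §4.3); the prohibition of degenerate scalars
at `Δ_{s,φ,t}` (redundant once the charge-`0,1,2` scalar thresholds exceed the window); a convergence clause
for derivative functionals (point functionals need none; cf. `HasConvergentWeights` of the archipelago file);
`O(2)` versus `SO(2)` (§2.1 footnote: the same crossing equations); the cutting-surface algorithm
(§3.3–§3.4), `SDPB`, `Λ = 43`, and every number of §4.  An enclosure proved WITHOUT an omitted (true) axiom is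
an enclosure under it a fortiori.

## References
* S. M. Chester, W. Landry, J. Liu, D. Poland, D. Simmons-Duffin, N. Su, A. Vichi, *Carving out OPE space and
  precise O(2) model critical exponents*, JHEP 06 (2020) 142, arXiv:1912.03324, §2.1–§2.2, §3.1–§3.3,
  appendix «Crossing vectors». [cite: ChesterEtAl2020]
* F. Kos, D. Poland, D. Simmons-Duffin, A. Vichi, *Bootstrapping the O(N) archipelago*, JHEP 11 (2015) 106,
  §2.1–§2.2 (`ONArchipelagoSystem.lean`, conventions). [cite: KosPolandSimmonsDuffinVichi2015]
* F. Kos, D. Poland, D. Simmons-Duffin, *Bootstrapping mixed correlators in the 3D Ising model*, JHEP 11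
  (2014) 109, §3.1 eq. (3.8), §4 (`crossF`, `IsConformalBlock3D`). [cite: KosPolandSimmonsduffin2014]
* M. Hogervorst, S. Rychkov, *Radial coordinates for conformal blocks*, Phys. Rev. D 87 (2013) 106004, §4.3
  (point functionals). [cite: HogervorstRychkov2013]
-/

noncomputable section

open Set Finset Matrix
open Literature.MathematicalPhysics.QuantumFieldTheory.ONVectorSumRule
open Literature.MathematicalPhysics.QuantumFieldTheory.O2ThreeScalarCrossing
open Literature.MathematicalPhysics.QuantumFieldTheory.ConformalBootstrap3D
  (IsConformalBlock3D unitarityBound3D crossF)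

namespace Literature.MathematicalPhysics.QuantumFieldTheory.O2ThreeScalarSystem

/-! ## 1. Genuine blocks as functions of the cross-ratios; the label parameters `(Δ_ij, Δ_kl)` -/

/-- Pull-back of a function of the cross-ratios `(u, v)` to the `z`-coordinates of the `σ–ε` files:
`pullbackZ G z z̄ = G (z z̄) ((1−z)(1−z̄))` (`u = z z̄`, `v = (1−z)(1−z̄)`).
[cite: KosPolandSimmonsduffin2014, §3.1 eq. (3.8)] -/
def pullbackZ (G : ℝ → ℝ → ℝ) : ℝ → ℝ → ℝ := fun z zb => G (z * zb) ((1 - z) * (1 - zb))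

/-- **Genuine block, cross-ratio form.** `IsBlockUV Δ₁₂ Δ₃₄ Δ ℓ G`: the pull-back `pullbackZ G` is the genuine 3D
block `g^{Δ₁₂,Δ₃₄}_{Δ,ℓ}(z, z̄)` of `SigmaEpsilonSystem.lean` on the square `z, z̄ ∈ (0,1)` (normalisation
`c_ℓ = 1`; the unitarity bound by continuity from above).  Only the values of `G` at points
`(z z̄, (1−z)(1−z̄))` are constrained. [cite: KosPolandSimmonsduffin2014, §4 eqs. (4.2)–(4.3)] -/
def IsBlockUV (Δ₁₂ Δ₃₄ Δ : ℝ) (ℓ : ℕ) (G : ℝ → ℝ → ℝ) : Prop :=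
  IsConformalBlock3D Δ₁₂ Δ₃₄ Δ ℓ (pullbackZ G)

/-- At a point `(u, v) = (z z̄, (1−z)(1−z̄))` the imported `F⁻ₓ[G](u,v) = vˣ G(u,v) − uˣ G(v,u)` is the
`z`-coordinate `crossF x (−1) (pullbackZ G) z z̄` (the crossed point `(v, u)` is `(1−z, 1−z̄)`).
[cite: KosPolandSimmonsduffin2014, §3.1 eq. (3.8)] -/
theorem Fm_pullbackZ (x : ℝ) (G : ℝ → ℝ → ℝ) (z zb : ℝ) :
    Fm x G (z * zb) ((1 - z) * (1 - zb)) = crossF x (-1) (pullbackZ G) z zb := by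
  simp only [Fm, crossF, pullbackZ, sub_sub_cancel]
  ring

/-- The same for `F⁺`. [cite: KosPolandSimmonsduffin2014, §3.1 eq. (3.8)] -/
theorem Fp_pullbackZ (x : ℝ) (G : ℝ → ℝ → ℝ) (z zb : ℝ) :
    Fp x G (z * zb) ((1 - z) * (1 - zb)) = crossF x 1 (pullbackZ G) z zb := by
  simp only [Fp, crossF, pullbackZ, sub_sub_cancel]
  ring

/-- Hence `F^{ij,kl}_{−}[g]` of a labelled family at such a point is `crossF (expo L) (−1) (pullbackZ (g L))`.
[cite: ChesterEtAl2020, §2.1 (`F^{ij,kl}_{∓,Δ,ℓ}`)] -/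
theorem Fminus_pullbackZ (D : Dims) (g : Label → ℝ → ℝ → ℝ) (L : Label) (z zb : ℝ) :
    Fminus D g L (z * zb) ((1 - z) * (1 - zb)) = crossF (D.expo L) (-1) (pullbackZ (g L)) z zb :=
  Fm_pullbackZ _ _ _ _

/-- And `F^{ij,kl}_{+}[g]` is `crossF (expo L) 1 (pullbackZ (g L))`. [cite: ChesterEtAl2020, §2.1 (`F^{ij,kl}_{∓,Δ,ℓ}`)] -/
theorem Fplus_pullbackZ (D : Dims) (g : Label → ℝ → ℝ → ℝ) (L : Label) (z zb : ℝ) :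
    Fplus D g L (z * zb) ((1 - z) * (1 - zb)) = crossF (D.expo L) 1 (pullbackZ (g L)) z zb :=
  Fp_pullbackZ _ _ _ _

/-- `Δ_ij = Δ_i − Δ_j` of the label `ij,kl` (the first superscript of `g^{Δ_ij,Δ_kl}`): `0` for
`φφφφ, tttt, ssss, ttφφ, ttss, φφss, φφst`; `tφtφ ↦ Δ_t−Δ_φ`, `φttφ ↦ Δ_φ−Δ_t`, `φsφs ↦ Δ_φ−Δ_s`,
`sφφs ↦ Δ_s−Δ_φ`, `φsφt ↦ Δ_φ−Δ_s`, `sφφt ↦ Δ_s−Δ_φ`, `tsts ↦ Δ_t−Δ_s`, `stts ↦ Δ_s−Δ_t`.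
[cite: ChesterEtAl2020, §2.1 (`F^{ij,kl}_{∓,Δ,ℓ}`)] -/
def d12 (D : Dims) : Label → ℝ
  | .φφφφ => 0
  | .tttt => 0
  | .ssss => 0
  | .ttφφ => 0
  | .ttss => 0
  | .φφss => 0
  | .tφtφ => D.Δt - D.Δφ
  | .φttφ => D.Δφ - D.Δt
  | .φsφs => D.Δφ - D.Δs
  | .sφφs => D.Δs - D.Δφ
  | .φsφt => D.Δφ - D.Δs
  | .sφφt => D.Δs - D.Δφ
  | .tsts => D.Δt - D.Δs
  | .stts => D.Δs - D.Δt
  | .φφst => 0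

/-- `Δ_kl = Δ_k − Δ_l` of the label `ij,kl` (the second superscript): `0` for `φφφφ, tttt, ssss, ttφφ, ttss,
φφss`; `tφtφ ↦ Δ_t−Δ_φ`, `φttφ ↦ Δ_t−Δ_φ`, `φsφs ↦ Δ_φ−Δ_s`, `sφφs ↦ Δ_φ−Δ_s`, `φsφt ↦ Δ_φ−Δ_t`,
`sφφt ↦ Δ_φ−Δ_t`, `tsts ↦ Δ_t−Δ_s`, `stts ↦ Δ_t−Δ_s`, `φφst ↦ Δ_s−Δ_t`.
[cite: ChesterEtAl2020, §2.1 (`F^{ij,kl}_{∓,Δ,ℓ}`)] -/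
def d34 (D : Dims) : Label → ℝ
  | .φφφφ => 0
  | .tttt => 0
  | .ssss => 0
  | .ttφφ => 0
  | .ttss => 0
  | .φφss => 0
  | .tφtφ => D.Δt - D.Δφ
  | .φttφ => D.Δt - D.Δφ
  | .φsφs => D.Δφ - D.Δs
  | .sφφs => D.Δφ - D.Δs
  | .φsφt => D.Δφ - D.Δt
  | .sφφt => D.Δφ - D.Δt
  | .tsts => D.Δt - D.Δs
  | .stts => D.Δt - D.Δs
  | .φφst => D.Δs - D.Δt

/-- A labelled family `g` is GENUINE at `(Δ, ℓ)` on the labels `S`: for every `L ∈ S`, `g L` is the genuine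
block `g^{Δ_ij(L),Δ_kl(L)}_{Δ,ℓ}` in cross-ratio form. [cite: ChesterEtAl2020, §2.1 (`F^{ij,kl}_{∓,Δ,ℓ}`)] -/
def GenuineOn (D : Dims) (S : List Label) (Δ : ℝ) (ℓ : ℕ) (g : Label → ℝ → ℝ → ℝ) : Prop :=
  ∀ L ∈ S, IsBlockUV (d12 D L) (d34 D L) Δ ℓ (g L)

/-- The labels used by the rows of `V⃗_{0⁺}` (`V0p`): `φφφφ, tttt, ssss, ttφφ, ttss, φφss` (all with
`Δ_ij = Δ_kl = 0`). [cite: ChesterEtAl2020, App. «Crossing vectors» (`V⃗_{0⁺,Δ,ℓ⁺}`)] -/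
def labels0p : List Label := [.φφφφ, .tttt, .ssss, .ttφφ, .ttss, .φφss]

/-- The labels used by `V⃗_{0⁻}` (`V0m`): `φφφφ, tttt, ttφφ`. [cite: ChesterEtAl2020, App. «Crossing vectors» (`V⃗_{0⁻,Δ,ℓ⁻}`)] -/
def labels0m : List Label := [.φφφφ, .tttt, .ttφφ]

/-- The labels used by `V⃗_1` (`V1`): `tφtφ, φttφ, φsφs, sφφs, φsφt, sφφt`.
[cite: ChesterEtAl2020, App. «Crossing vectors» (`V⃗_{1,Δ,ℓ}`)] -/
def labels1 : List Label := [.tφtφ, .φttφ, .φsφs, .sφφs, .φsφt, .sφφt]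

/-- The labels used by `V⃗_{2⁺}` (`V2p`): `φφφφ, tsts, stts, φφst`. [cite: ChesterEtAl2020, App. «Crossing vectors» (`V⃗_{2,Δ,ℓ⁺}`)] -/
def labels2p : List Label := [.φφφφ, .tsts, .stts, .φφst]

/-- The labels used by `V⃗_{2⁻}` (`V2m`): `tsts, stts`. [cite: ChesterEtAl2020, App. «Crossing vectors» (`V⃗_{2,Δ,ℓ⁻}`)] -/
def labels2m : List Label := [.tsts, .stts]

/-- The labels used by `V⃗_3` (`V3`): `tφtφ, φttφ`. [cite: ChesterEtAl2020, App. «Crossing vectors» (`V⃗_{3,Δ,ℓ}`)] -/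
def labels3 : List Label := [.tφtφ, .φttφ]

/-- The label used by `V⃗_4` (`V4`): `tttt`. [cite: ChesterEtAl2020, App. «Crossing vectors» (`V⃗_{4,Δ,ℓ⁺}`)] -/
def labels4 : List Label := [.tttt]

/-! ## 2. The datum and the parametrised spectral assumptions -/

/-- **`O(2)` three-scalar datum** — what the semidefinite programme of the source sees of a CFT with the
lowest scalars `s` (charge `0⁺`), `φ` (charge `1`), `t` (charge `2`): the external dimensions `D = (Δ_s, Δ_φ,
Δ_t)`; the external couplings `lam = λ_ext = (λ_{sss}, λ_{φφs}, λ_{tts}, λ_{φφt})` with the block families of the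
exchanged `s` (`gs`, at `(Δ_s, 0)` in `0⁺`), `φ` (`gφ`, at `(Δ_φ, 0)` in charge `1`) and `t` (`gt`, at `(Δ_t, 0)`
in `2⁺`); and the seven indexed families of the OTHER exchanged primaries, sector by sector, each member with
its dimension, spin, real couplings in the source's basis and block family: `0⁺` (other than `𝟙` and `s`;
couplings `(λ_{ss𝒪}, λ_{φφ𝒪}, λ_{tt𝒪}) = (a0, b0, c0)`), `0⁻` (`(λ_{φφ𝒪}, λ_{tt𝒪}) = (b0m, c0m)`), charge `1`
(other than `φ`; `(λ_{φs𝒪}, λ_{tφ𝒪}) = (x1, y1)`), `2⁺` (other than `t`; `(λ_{φφ𝒪}, λ_{ts𝒪}) = (b2, z2)`), `2⁻`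
(`λ_{ts𝒪} = lam2m`), charge `3` (`λ_{tφ𝒪} = lam3`), charge `4` (`λ_{tt𝒪} = lam4`).  An operator absent from one
OPE has that coupling `0`.  Positivity of the OPE data is built in: the couplings are real.
[cite: ChesterEtAl2020, §2.1 (crossing equations)] -/
structure O2Data where
  /-- `(Δ_s, Δ_φ, Δ_t)`. -/
  D : Dims
  /-- `λ_ext = (λ_{sss}, λ_{φφs}, λ_{tts}, λ_{φφt})`. -/
  lam : Fin 4 → ℝ
  /-- Block family of the exchanged `s` (`0⁺`, `ℓ = 0`, `Δ = Δ_s`). -/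
  gs : Label → ℝ → ℝ → ℝ
  /-- Block family of the exchanged `φ` (charge `1`, `ℓ = 0`, `Δ = Δ_φ`). -/
  gφ : Label → ℝ → ℝ → ℝ
  /-- Block family of the exchanged `t` (`2⁺`, `ℓ = 0`, `Δ = Δ_t`). -/
  gt : Label → ℝ → ℝ → ℝ
  /-- Index type of the `0⁺` primaries other than `𝟙` and `s`. -/
  ι0p : Type
  /-- Dimensions (`0⁺`). -/
  Δ0p : ι0p → ℝ
  /-- Spins (`0⁺`). -/
  ℓ0p : ι0p → ℕ
  /-- `λ_{ss𝒪}` (`0⁺`). -/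
  a0 : ι0p → ℝ
  /-- `λ_{φφ𝒪}` (`0⁺`). -/
  b0 : ι0p → ℝ
  /-- `λ_{tt𝒪}` (`0⁺`). -/
  c0 : ι0p → ℝ
  /-- Block families (`0⁺`). -/
  g0p : ι0p → Label → ℝ → ℝ → ℝ
  /-- Index type of the `0⁻` primaries. -/
  ι0m : Type
  /-- Dimensions (`0⁻`). -/
  Δ0m : ι0m → ℝ
  /-- Spins (`0⁻`). -/
  ℓ0m : ι0m → ℕ
  /-- `λ_{φφ𝒪}` (`0⁻`). -/
  b0m : ι0m → ℝ
  /-- `λ_{tt𝒪}` (`0⁻`). -/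
  c0m : ι0m → ℝ
  /-- Block families (`0⁻`). -/
  g0m : ι0m → Label → ℝ → ℝ → ℝ
  /-- Index type of the charge-`1` primaries other than `φ`. -/
  ι1 : Type
  /-- Dimensions (charge `1`). -/
  Δ1 : ι1 → ℝ
  /-- Spins (charge `1`). -/
  ℓ1 : ι1 → ℕ
  /-- `λ_{φs𝒪}` (charge `1`). -/
  x1 : ι1 → ℝ
  /-- `λ_{tφ𝒪}` (charge `1`). -/
  y1 : ι1 → ℝ
  /-- Block families (charge `1`). -/
  g1 : ι1 → Label → ℝ → ℝ → ℝ
  /-- Index type of the `2⁺` primaries other than `t`. -/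
  ι2p : Type
  /-- Dimensions (`2⁺`). -/
  Δ2p : ι2p → ℝ
  /-- Spins (`2⁺`). -/
  ℓ2p : ι2p → ℕ
  /-- `λ_{φφ𝒪}` (`2⁺`). -/
  b2 : ι2p → ℝ
  /-- `λ_{ts𝒪}` (`2⁺`). -/
  z2 : ι2p → ℝ
  /-- Block families (`2⁺`). -/
  g2p : ι2p → Label → ℝ → ℝ → ℝ
  /-- Index type of the `2⁻` primaries. -/
  ι2m : Type
  /-- Dimensions (`2⁻`). -/
  Δ2m : ι2m → ℝ
  /-- Spins (`2⁻`). -/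
  ℓ2m : ι2m → ℕ
  /-- `λ_{ts𝒪}` (`2⁻`). -/
  lam2m : ι2m → ℝ
  /-- Block families (`2⁻`). -/
  g2m : ι2m → Label → ℝ → ℝ → ℝ
  /-- Index type of the charge-`3` primaries. -/
  ι3 : Type
  /-- Dimensions (charge `3`). -/
  Δ3 : ι3 → ℝ
  /-- Spins (charge `3`). -/
  ℓ3 : ι3 → ℕ
  /-- `λ_{tφ𝒪}` (charge `3`). -/
  lam3 : ι3 → ℝ
  /-- Block families (charge `3`). -/
  g3 : ι3 → Label → ℝ → ℝ → ℝ
  /-- Index type of the charge-`4` primaries. -/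
  ι4 : Type
  /-- Dimensions (charge `4`). -/
  Δ4 : ι4 → ℝ
  /-- Spins (charge `4`). -/
  ℓ4 : ι4 → ℕ
  /-- `λ_{tt𝒪}` (charge `4`). -/
  lam4 : ι4 → ℝ
  /-- Block families (charge `4`). -/
  g4 : ι4 → Label → ℝ → ℝ → ℝ

/-- **The spectral assumptions of §2.2, parametrised.**  `Δ0, Δ1, Δ2`: lower bounds on the dimensions of the
charge-`0⁺`, `1`, `2⁺` SCALARS other than `s, φ, t` (source: `3, 3, 3`); `Δ3`: on the charge-`3` scalars
(source: `1`); `Δ4`: on the charge-`4` scalars (source: `3`, initial study `1`); `δτ`: the twist gap of the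
non-scalar primaries above the current and the stress tensor (source: `10⁻⁶`).  `1/2` in a scalar slot and
`0` for `δτ` mean "no assumption" (`freeGaps`, `satisfiesGaps_free`). [cite: ChesterEtAl2020, §2.2 (assumptions about the spectrum)] -/
structure O2Gaps where
  /-- Threshold for the `0⁺` scalars other than `s`. -/
  Δ0 : ℝ
  /-- Threshold for the charge-`1` scalars other than `φ`. -/
  Δ1 : ℝ
  /-- Threshold for the `2⁺` scalars other than `t`. -/
  Δ2 : ℝ
  /-- Threshold for the charge-`3` scalars. -/
  Δ3 : ℝ
  /-- Threshold for the charge-`4` scalars. -/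
  Δ4 : ℝ
  /-- Twist gap `δ_τ` for non-scalars above `J` and `T`. -/
  δτ : ℝ

/-- "No assumption": every scalar threshold at the unitarity value `1/2`, no twist gap.
[cite: ChesterEtAl2020, §2.2 (assumptions about the spectrum)] -/
def freeGaps : O2Gaps := ⟨1 / 2, 1 / 2, 1 / 2, 1 / 2, 1 / 2, 0⟩

/-- The assumptions of most of the source's work as quoted in the module docstring: `Δ ≥ 3` for the
charge-`0, 1, 2` scalars after `s, φ, t`, `Δ ≥ 1` for charge-`3` scalars, `Δ ≥ 3` for charge-`4` scalars,
`δ_τ = 10⁻⁶`. [cite: ChesterEtAl2020, §2.2 (assumptions about the spectrum)] -/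
def chesterGaps : O2Gaps := ⟨3, 3, 3, 1, 3, 1 / 10 ^ 6⟩

/-- The assumptions of the source's "initial study": as `chesterGaps` but `Δ ≥ 1` for charge-`4` scalars.
[cite: ChesterEtAl2020, §2.2 (assumptions about the spectrum)] -/
def chesterGapsInitial : O2Gaps := ⟨3, 3, 3, 1, 1, 1 / 10 ^ 6⟩

namespace O2Gaps

/-- `A'.Weaker A`: the assumptions `A'` are implied by `A` (every threshold of `A'` is at most that of `A`).
[cite: ChesterEtAl2020, §2.2 (assumptions about the spectrum)] -/
def Weaker (A' A : O2Gaps) : Prop :=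
  A'.Δ0 ≤ A.Δ0 ∧ A'.Δ1 ≤ A.Δ1 ∧ A'.Δ2 ≤ A.Δ2 ∧ A'.Δ3 ≤ A.Δ3 ∧ A'.Δ4 ≤ A.Δ4 ∧ A'.δτ ≤ A.δτ

/-- `Weaker` is reflexive. [cite: ChesterEtAl2020, §2.2 (assumptions about the spectrum)] -/
theorem Weaker.rfl {A : O2Gaps} : A.Weaker A :=
  ⟨le_rfl, le_rfl, le_rfl, le_rfl, le_rfl, le_rfl⟩

/-- `Weaker` is transitive. [cite: ChesterEtAl2020, §2.2 (assumptions about the spectrum)] -/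
theorem Weaker.trans {A A' A'' : O2Gaps} (h : A''.Weaker A') (h' : A'.Weaker A) : A''.Weaker A :=
  ⟨h.1.trans h'.1, h.2.1.trans h'.2.1, h.2.2.1.trans h'.2.2.1, h.2.2.2.1.trans h'.2.2.2.1,
    h.2.2.2.2.1.trans h'.2.2.2.2.1, h.2.2.2.2.2.trans h'.2.2.2.2.2⟩

/-- The initial study's assumptions are weaker than the main ones. [cite: ChesterEtAl2020, §2.2 (assumptions about the spectrum)] -/
theorem chesterGapsInitial_weaker : chesterGapsInitial.Weaker chesterGaps := by
  refine ⟨?_, ?_, ?_, ?_, ?_, ?_⟩ <;> norm_num [chesterGaps, chesterGapsInitial]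

/-- **Admissible `0⁺` primaries** `(Δ, ℓ)` under A1 + A4 against `A`: even spin, the unitarity bound, the
scalar threshold `Δ0`, and for `ℓ ≥ 1` the twist gap `Δ ≥ ℓ + 1 + δτ` unless `(ℓ, Δ) = (2, 3)` (the stress
tensor). [cite: ChesterEtAl2020, §2.2 (assumptions about the spectrum)] -/
def Allows0p (A : O2Gaps) (Δ : ℝ) (ℓ : ℕ) : Prop :=
  Even ℓ ∧ unitarityBound3D ℓ ≤ Δ ∧ (ℓ = 0 → A.Δ0 ≤ Δ) ∧
    (1 ≤ ℓ → (ℓ = 2 ∧ Δ = 3) ∨ (ℓ : ℝ) + 1 + A.δτ ≤ Δ)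

/-- **Admissible `0⁻` primaries**: odd spin, the unitarity bound, the twist gap unless `(ℓ, Δ) = (1, 2)` (the
current `J`). [cite: ChesterEtAl2020, §2.2 (assumptions about the spectrum)] -/
def Allows0m (A : O2Gaps) (Δ : ℝ) (ℓ : ℕ) : Prop :=
  Odd ℓ ∧ unitarityBound3D ℓ ≤ Δ ∧ ((ℓ = 1 ∧ Δ = 2) ∨ (ℓ : ℝ) + 1 + A.δτ ≤ Δ)

/-- **Admissible charge-`1` primaries** (other than `φ`): any spin, the unitarity bound, the scalar threshold
`Δ1`, the twist gap for `ℓ ≥ 1`. [cite: ChesterEtAl2020, §2.2 (assumptions about the spectrum)] -/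
def Allows1 (A : O2Gaps) (Δ : ℝ) (ℓ : ℕ) : Prop :=
  unitarityBound3D ℓ ≤ Δ ∧ (ℓ = 0 → A.Δ1 ≤ Δ) ∧ (1 ≤ ℓ → (ℓ : ℝ) + 1 + A.δτ ≤ Δ)

/-- **Admissible `2⁺` primaries** (other than `t`): even spin, the unitarity bound, the scalar threshold `Δ2`,
the twist gap for `ℓ ≥ 1`. [cite: ChesterEtAl2020, §2.2 (assumptions about the spectrum)] -/
def Allows2p (A : O2Gaps) (Δ : ℝ) (ℓ : ℕ) : Prop :=
  Even ℓ ∧ unitarityBound3D ℓ ≤ Δ ∧ (ℓ = 0 → A.Δ2 ≤ Δ) ∧ (1 ≤ ℓ → (ℓ : ℝ) + 1 + A.δτ ≤ Δ)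

/-- **Admissible `2⁻` primaries**: odd spin, the unitarity bound, the twist gap.
[cite: ChesterEtAl2020, §2.2 (assumptions about the spectrum)] -/
def Allows2m (A : O2Gaps) (Δ : ℝ) (ℓ : ℕ) : Prop :=
  Odd ℓ ∧ unitarityBound3D ℓ ≤ Δ ∧ (ℓ : ℝ) + 1 + A.δτ ≤ Δ

/-- **Admissible charge-`3` primaries**: any spin, the unitarity bound, the scalar threshold `Δ3`, the twist
gap for `ℓ ≥ 1`. [cite: ChesterEtAl2020, §2.2 (assumptions about the spectrum)] -/
def Allows3 (A : O2Gaps) (Δ : ℝ) (ℓ : ℕ) : Prop :=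
  unitarityBound3D ℓ ≤ Δ ∧ (ℓ = 0 → A.Δ3 ≤ Δ) ∧ (1 ≤ ℓ → (ℓ : ℝ) + 1 + A.δτ ≤ Δ)

/-- **Admissible charge-`4` primaries**: even spin, the unitarity bound, the scalar threshold `Δ4`, the twist
gap for `ℓ ≥ 1`. [cite: ChesterEtAl2020, §2.2 (assumptions about the spectrum)] -/
def Allows4 (A : O2Gaps) (Δ : ℝ) (ℓ : ℕ) : Prop :=
  Even ℓ ∧ unitarityBound3D ℓ ≤ Δ ∧ (ℓ = 0 → A.Δ4 ≤ Δ) ∧ (1 ≤ ℓ → (ℓ : ℝ) + 1 + A.δτ ≤ Δ)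

end O2Gaps

namespace O2Data

/-- **A2 — genuine blocks.**  The block families of the exchanged `s, φ, t` and of every indexed primary are
genuine (`GenuineOn`) at their `(Δ, ℓ)` on the labels their sector's rows use (`labels0p … labels4`).
[cite: ChesterEtAl2020, §2.1 (`F^{ij,kl}_{∓,Δ,ℓ}`)] -/
def HasGenuineBlocks (X : O2Data) : Prop :=
  GenuineOn X.D labels0p X.D.Δs 0 X.gs ∧ GenuineOn X.D labels1 X.D.Δφ 0 X.gφ ∧
    GenuineOn X.D labels2p X.D.Δt 0 X.gt ∧
    (∀ i, GenuineOn X.D labels0p (X.Δ0p i) (X.ℓ0p i) (X.g0p i)) ∧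
    (∀ i, GenuineOn X.D labels0m (X.Δ0m i) (X.ℓ0m i) (X.g0m i)) ∧
    (∀ i, GenuineOn X.D labels1 (X.Δ1 i) (X.ℓ1 i) (X.g1 i)) ∧
    (∀ i, GenuineOn X.D labels2p (X.Δ2p i) (X.ℓ2p i) (X.g2p i)) ∧
    (∀ i, GenuineOn X.D labels2m (X.Δ2m i) (X.ℓ2m i) (X.g2m i)) ∧
    (∀ i, GenuineOn X.D labels3 (X.Δ3 i) (X.ℓ3 i) (X.g3 i)) ∧
      ∀ i, GenuineOn X.D labels4 (X.Δ4 i) (X.ℓ4 i) (X.g4 i)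

/-- **A1 — unitarity (spectral part) and spin parities.**  `Δ_s, Δ_φ, Δ_t ≥ 1/2`; every exchanged primary
obeys the 3D unitarity bound; `0⁺`, `2⁺`, `4` have even spins, `0⁻`, `2⁻` odd spins, charges `1`, `3` any spin
(source §2.1: *"where `ℓ^±` denotes which spins appear"*, Table 1).
[cite: ChesterEtAl2020, §2.1 (crossing equations)] -/
def SatisfiesUnitarity (X : O2Data) : Prop :=
  1 / 2 ≤ X.D.Δs ∧ 1 / 2 ≤ X.D.Δφ ∧ 1 / 2 ≤ X.D.Δt ∧
    (∀ i, unitarityBound3D (X.ℓ0p i) ≤ X.Δ0p i ∧ Even (X.ℓ0p i)) ∧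
    (∀ i, unitarityBound3D (X.ℓ0m i) ≤ X.Δ0m i ∧ Odd (X.ℓ0m i)) ∧
    (∀ i, unitarityBound3D (X.ℓ1 i) ≤ X.Δ1 i) ∧
    (∀ i, unitarityBound3D (X.ℓ2p i) ≤ X.Δ2p i ∧ Even (X.ℓ2p i)) ∧
    (∀ i, unitarityBound3D (X.ℓ2m i) ≤ X.Δ2m i ∧ Odd (X.ℓ2m i)) ∧
    (∀ i, unitarityBound3D (X.ℓ3 i) ≤ X.Δ3 i) ∧
      ∀ i, unitarityBound3D (X.ℓ4 i) ≤ X.Δ4 i ∧ Even (X.ℓ4 i)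

/-- **A3 — crossing**, the crossing equation of §2.1 at every point `(u, v) = (z z̄, (1−z)(1−z̄))`, `z, z̄ ∈ (0,1)`
real, as `HasSum` identities: the seven sector series of 22-vectors converge separately there (to `T0p … T4`;
they do, absolutely, in a unitary CFT) and `(1 1 1) V⃗_{0⁺,0,0} (1;1;1) + λ_extᵀ V⃗_ext λ_ext + T0p + T0m + T1 +
T2p + T2m + T3 + T4 = 0`, with the unit written out (`unitBlocks`, couplings `(1,1,1)`), the exchanged `s, φ, t`
collected in `λ_extᵀ V⃗_ext λ_ext` (`quadVext`), and the spin signs `ε = (−1)^ℓ` of `V⃗_1`, `V⃗_3`.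
[cite: ChesterEtAl2020, §2.1 (crossing equations)] -/
def SatisfiesCrossing (X : O2Data) : Prop :=
  ∀ z zb : ℝ, z ∈ Ioo (0 : ℝ) 1 → zb ∈ Ioo (0 : ℝ) 1 →
    ∃ T0p T0m T1 T2p T2m T3 T4 : Fin 22 → ℝ,
      HasSum (fun i => quad0p X.D (X.a0 i) (X.b0 i) (X.c0 i) (X.g0p i) (z * zb) ((1 - z) * (1 - zb)))
          T0p ∧
        HasSum (fun i => quad0m X.D (X.b0m i) (X.c0m i) (X.g0m i) (z * zb) ((1 - z) * (1 - zb))) T0m ∧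
        HasSum (fun i => quad1 X.D (X.x1 i) (X.y1 i) ((-1) ^ X.ℓ1 i) (X.g1 i) (z * zb)
          ((1 - z) * (1 - zb))) T1 ∧
        HasSum (fun i => quad2p X.D (X.b2 i) (X.z2 i) (X.g2p i) (z * zb) ((1 - z) * (1 - zb))) T2p ∧
        HasSum (fun i => X.lam2m i ^ 2 • V2m X.D (X.g2m i) (z * zb) ((1 - z) * (1 - zb))) T2m ∧
        HasSum (fun i => X.lam3 i ^ 2 • V3 X.D ((-1) ^ X.ℓ3 i) (X.g3 i) (z * zb) ((1 - z) * (1 - zb)))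
          T3 ∧
        HasSum (fun i => X.lam4 i ^ 2 • V4 X.D (X.g4 i) (z * zb) ((1 - z) * (1 - zb))) T4 ∧
          quad0p X.D 1 1 1 unitBlocks (z * zb) ((1 - z) * (1 - zb)) +
              quadVext X.D X.lam X.gs X.gφ X.gt (z * zb) ((1 - z) * (1 - zb)) +
            T0p + T0m + T1 + T2p + T2m + T3 + T4 = 0

/-- **A4 — the spectral assumptions** against `A`: the scalars of the sectors `0⁺, 1, 2⁺, 3, 4` lie above the
thresholds `Δ0, Δ1, Δ2, Δ3, Δ4`; every primary of spin `ℓ ≥ 1` has twist `Δ − ℓ ≥ 1 + δτ`, except the `0⁻`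
primaries at `(ℓ, Δ) = (1, 2)` and the `0⁺` primaries at `(ℓ, Δ) = (2, 3)` (module docstring, §2.2).
[cite: ChesterEtAl2020, §2.2 (assumptions about the spectrum)] -/
def SatisfiesGaps (X : O2Data) (A : O2Gaps) : Prop :=
  (∀ i, X.ℓ0p i = 0 → A.Δ0 ≤ X.Δ0p i) ∧ (∀ i, X.ℓ1 i = 0 → A.Δ1 ≤ X.Δ1 i) ∧
    (∀ i, X.ℓ2p i = 0 → A.Δ2 ≤ X.Δ2p i) ∧ (∀ i, X.ℓ3 i = 0 → A.Δ3 ≤ X.Δ3 i) ∧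
    (∀ i, X.ℓ4 i = 0 → A.Δ4 ≤ X.Δ4 i) ∧
    (∀ i, 1 ≤ X.ℓ0p i → (X.ℓ0p i = 2 ∧ X.Δ0p i = 3) ∨ (X.ℓ0p i : ℝ) + 1 + A.δτ ≤ X.Δ0p i) ∧
    (∀ i, (X.ℓ0m i = 1 ∧ X.Δ0m i = 2) ∨ (X.ℓ0m i : ℝ) + 1 + A.δτ ≤ X.Δ0m i) ∧
    (∀ i, 1 ≤ X.ℓ1 i → (X.ℓ1 i : ℝ) + 1 + A.δτ ≤ X.Δ1 i) ∧
    (∀ i, 1 ≤ X.ℓ2p i → (X.ℓ2p i : ℝ) + 1 + A.δτ ≤ X.Δ2p i) ∧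
    (∀ i, (X.ℓ2m i : ℝ) + 1 + A.δτ ≤ X.Δ2m i) ∧
    (∀ i, 1 ≤ X.ℓ3 i → (X.ℓ3 i : ℝ) + 1 + A.δτ ≤ X.Δ3 i) ∧
      ∀ i, 1 ≤ X.ℓ4 i → (X.ℓ4 i : ℝ) + 1 + A.δτ ≤ X.Δ4 i

/-- **The typed `O(2)` axioms A1–A4** against the thresholds `A` (OPE-coefficient symmetry of the externals is
built into the datum: one `λ_ext` serves all three exchanged-external terms).
[cite: ChesterEtAl2020, §2.2 (assumptions about the spectrum)] -/
def SatisfiesO2Axioms (X : O2Data) (A : O2Gaps) : Prop :=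
  X.HasGenuineBlocks ∧ X.SatisfiesUnitarity ∧ X.SatisfiesCrossing ∧ X.SatisfiesGaps A

variable {X : O2Data} {A A' : O2Gaps}

/-- A4 is antitone in the thresholds: weaker assumptions are implied. [cite: ChesterEtAl2020, §2.2 (assumptions about the spectrum)] -/
theorem SatisfiesGaps.of_weaker (h : X.SatisfiesGaps A) (hw : A'.Weaker A) : X.SatisfiesGaps A' := by
  obtain ⟨h0, h1, h2, h3, h4, t0p, t0m, t1, t2p, t2m, t3, t4⟩ := h
  obtain ⟨w0, w1, w2, w3, w4, wτ⟩ := hw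
  refine ⟨fun i hi => w0.trans (h0 i hi), fun i hi => w1.trans (h1 i hi), fun i hi => w2.trans (h2 i hi),
    fun i hi => w3.trans (h3 i hi), fun i hi => w4.trans (h4 i hi), fun i hi => ?_, fun i => ?_,
    fun i hi => ?_, fun i hi => ?_, fun i => ?_, fun i hi => ?_, fun i hi => ?_⟩
  · rcases t0p i hi with h | h
    · exact Or.inl h
    · exact Or.inr (by linarith)
  · rcases t0m i with h | h
    · exact Or.inl h
    · exact Or.inr (by linarith)
  · linarith [t1 i hi]
  · linarith [t2p i hi]
  · linarith [t2m i]
  · linarith [t3 i hi]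
  · linarith [t4 i hi]

/-- The same for the conjoined axioms. [cite: ChesterEtAl2020, §2.2 (assumptions about the spectrum)] -/
theorem SatisfiesO2Axioms.of_weaker (h : X.SatisfiesO2Axioms A) (hw : A'.Weaker A) :
    X.SatisfiesO2Axioms A' :=
  ⟨h.1, h.2.1, h.2.2.1, h.2.2.2.of_weaker hw⟩

/-- With no assumption at all (`freeGaps`) A4 follows from A1. [cite: ChesterEtAl2020, §2.2 (assumptions about the spectrum)] -/
theorem satisfiesGaps_free (h : X.SatisfiesUnitarity) : X.SatisfiesGaps freeGaps := by
  obtain ⟨-, -, -, u0p, u0m, u1, u2p, u2m, u3, u4⟩ := h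
  have hb0 : unitarityBound3D 0 = 1 / 2 := by simp [unitarityBound3D]
  have hb : ∀ ℓ : ℕ, 1 ≤ ℓ → unitarityBound3D ℓ = (ℓ : ℝ) + 1 := fun ℓ hℓ => by
    simp [unitarityBound3D, Nat.one_le_iff_ne_zero.mp hℓ]
  refine ⟨fun i hi => ?_, fun i hi => ?_, fun i hi => ?_, fun i hi => ?_, fun i hi => ?_, fun i hi => ?_,
    fun i => ?_, fun i hi => ?_, fun i hi => ?_, fun i => ?_, fun i hi => ?_, fun i hi => ?_⟩
  · have := (u0p i).1; rw [hi, hb0] at this; exact this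
  · have := u1 i; rw [hi, hb0] at this; exact this
  · have := (u2p i).1; rw [hi, hb0] at this; exact this
  · have := u3 i; rw [hi, hb0] at this; exact this
  · have := (u4 i).1; rw [hi, hb0] at this; exact this
  · have := (u0p i).1; rw [hb _ hi] at this; exact Or.inr (by simpa [freeGaps] using this)
  · have hi : 1 ≤ X.ℓ0m i := Nat.one_le_iff_ne_zero.mpr fun h0 => by
      have := (u0m i).2; rw [h0] at this; exact Nat.not_odd_zero this
    have := (u0m i).1; rw [hb _ hi] at this; exact Or.inr (by simpa [freeGaps] using this)
  · have := u1 i; rw [hb _ hi] at this; simpa [freeGaps] using this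
  · have := (u2p i).1; rw [hb _ hi] at this; simpa [freeGaps] using this
  · have hi : 1 ≤ X.ℓ2m i := Nat.one_le_iff_ne_zero.mpr fun h0 => by
      have := (u2m i).2; rw [h0] at this; exact Nat.not_odd_zero this
    have := (u2m i).1; rw [hb _ hi] at this; simpa [freeGaps] using this
  · have := u3 i; rw [hb _ hi] at this; simpa [freeGaps] using this
  · have := (u4 i).1; rw [hb _ hi] at this; simpa [freeGaps] using this

/-- Under A1 + A4 every indexed `0⁺` primary is admissible. [cite: ChesterEtAl2020, §2.2 (assumptions about the spectrum)] -/
theorem allows0p (h1 : X.SatisfiesUnitarity) (h4 : X.SatisfiesGaps A) (i : X.ι0p) :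
    A.Allows0p (X.Δ0p i) (X.ℓ0p i) :=
  ⟨(h1.2.2.2.1 i).2, (h1.2.2.2.1 i).1, h4.1 i, h4.2.2.2.2.2.1 i⟩

/-- Under A1 + A4 every indexed `0⁻` primary is admissible. [cite: ChesterEtAl2020, §2.2 (assumptions about the spectrum)] -/
theorem allows0m (h1 : X.SatisfiesUnitarity) (h4 : X.SatisfiesGaps A) (i : X.ι0m) :
    A.Allows0m (X.Δ0m i) (X.ℓ0m i) :=
  ⟨(h1.2.2.2.2.1 i).2, (h1.2.2.2.2.1 i).1, h4.2.2.2.2.2.2.1 i⟩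

/-- Under A1 + A4 every indexed charge-`1` primary is admissible. [cite: ChesterEtAl2020, §2.2 (assumptions about the spectrum)] -/
theorem allows1 (h1 : X.SatisfiesUnitarity) (h4 : X.SatisfiesGaps A) (i : X.ι1) :
    A.Allows1 (X.Δ1 i) (X.ℓ1 i) :=
  ⟨h1.2.2.2.2.2.1 i, h4.2.1 i, h4.2.2.2.2.2.2.2.1 i⟩

/-- Under A1 + A4 every indexed `2⁺` primary is admissible. [cite: ChesterEtAl2020, §2.2 (assumptions about the spectrum)] -/
theorem allows2p (h1 : X.SatisfiesUnitarity) (h4 : X.SatisfiesGaps A) (i : X.ι2p) :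
    A.Allows2p (X.Δ2p i) (X.ℓ2p i) :=
  ⟨(h1.2.2.2.2.2.2.1 i).2, (h1.2.2.2.2.2.2.1 i).1, h4.2.2.1 i, h4.2.2.2.2.2.2.2.2.1 i⟩

/-- Under A1 + A4 every indexed `2⁻` primary is admissible. [cite: ChesterEtAl2020, §2.2 (assumptions about the spectrum)] -/
theorem allows2m (h1 : X.SatisfiesUnitarity) (h4 : X.SatisfiesGaps A) (i : X.ι2m) :
    A.Allows2m (X.Δ2m i) (X.ℓ2m i) :=
  ⟨(h1.2.2.2.2.2.2.2.1 i).2, (h1.2.2.2.2.2.2.2.1 i).1, h4.2.2.2.2.2.2.2.2.2.1 i⟩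

/-- Under A1 + A4 every indexed charge-`3` primary is admissible. [cite: ChesterEtAl2020, §2.2 (assumptions about the spectrum)] -/
theorem allows3 (h1 : X.SatisfiesUnitarity) (h4 : X.SatisfiesGaps A) (i : X.ι3) :
    A.Allows3 (X.Δ3 i) (X.ℓ3 i) :=
  ⟨h1.2.2.2.2.2.2.2.2.1 i, h4.2.2.2.1 i, h4.2.2.2.2.2.2.2.2.2.2.1 i⟩

/-- Under A1 + A4 every indexed charge-`4` primary is admissible. [cite: ChesterEtAl2020, §2.2 (assumptions about the spectrum)] -/
theorem allows4 (h1 : X.SatisfiesUnitarity) (h4 : X.SatisfiesGaps A) (i : X.ι4) :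
    A.Allows4 (X.Δ4 i) (X.ℓ4 i) :=
  ⟨(h1.2.2.2.2.2.2.2.2.2 i).2, (h1.2.2.2.2.2.2.2.2.2 i).1, h4.2.2.2.2.1 i, h4.2.2.2.2.2.2.2.2.2.2.2 i⟩

end O2Data

/-! ## 3. The windowed enclosure statement and its assembly from excluded boxes -/

/-- **Windowed enclosure.** `O2Enclosure A W R`: every `O(2)` three-scalar datum satisfying A1–A4 against `A`
whose `(Δ_s, Δ_φ, Δ_t)` lies in the window `W` has `(Δ_s, Δ_φ, Δ_t) ∈ R`.  The window is essential (the source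
scans a bounded region around the island; generalised free fields satisfy the axioms with suitable
thresholds far away). [cite: ChesterEtAl2020, §3.3 (allowed and disallowed points)] -/
def O2Enclosure (A : O2Gaps) (W R : Set (ℝ × ℝ × ℝ)) : Prop :=
  ∀ X : O2Data, X.SatisfiesO2Axioms A → (X.D.Δs, X.D.Δφ, X.D.Δt) ∈ W → (X.D.Δs, X.D.Δφ, X.D.Δt) ∈ R

/-- A set `Q` of external dimensions is *excluded* (against `A`) if no datum satisfying the axioms has
`(Δ_s, Δ_φ, Δ_t) ∈ Q`: *"the point `(Δ_s, Δ_φ, Δ_t)` is disallowed"* for every point of `Q`.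
[cite: ChesterEtAl2020, §3.3 (allowed and disallowed points)] -/
def BoxExcluded (A : O2Gaps) (Q : Set (ℝ × ℝ × ℝ)) : Prop :=
  ∀ X : O2Data, X.SatisfiesO2Axioms A → (X.D.Δs, X.D.Δφ, X.D.Δt) ∉ Q

namespace O2Enclosure

variable {A A' : O2Gaps} {W W' W₁ W₂ R R' R₁ R₂ : Set (ℝ × ℝ × ℝ)}

/-- Monotonicity: a smaller window, a larger region. [cite: ChesterEtAl2020, §3.3 (allowed and disallowed points)] -/
theorem mono (h : O2Enclosure A W R) (hW : W' ⊆ W) (hR : R ⊆ R') : O2Enclosure A W' R' :=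
  fun X hX hmem => hR (h X hX (hW hmem))

/-- Monotonicity in the assumptions: an enclosure proved under WEAKER assumptions holds under stronger ones.
[cite: ChesterEtAl2020, §2.2 (assumptions about the spectrum)] -/
theorem of_weaker (h : O2Enclosure A' W R) (hw : A'.Weaker A) : O2Enclosure A W R :=
  fun X hX hmem => h X (hX.of_weaker hw) hmem

/-- Two enclosures on the same window intersect. [cite: ChesterEtAl2020, §3.3 (allowed and disallowed points)] -/
theorem inter (h₁ : O2Enclosure A W R₁) (h₂ : O2Enclosure A W R₂) : O2Enclosure A W (R₁ ∩ R₂) :=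
  fun X hX hmem => ⟨h₁ X hX hmem, h₂ X hX hmem⟩

/-- Enclosures glue along a union of windows. [cite: ChesterEtAl2020, §3.3 (allowed and disallowed points)] -/
theorem union (h₁ : O2Enclosure A W₁ R) (h₂ : O2Enclosure A W₂ R) : O2Enclosure A (W₁ ∪ W₂) R :=
  fun X hX hmem => hmem.elim (h₁ X hX) (h₂ X hX)

end O2Enclosure

namespace BoxExcluded

variable {A A' : O2Gaps} {Q Q' : Set (ℝ × ℝ × ℝ)}

/-- An excluded set is an enclosure with empty region. [cite: ChesterEtAl2020, §3.3 (allowed and disallowed points)] -/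
theorem enclosure (h : BoxExcluded A Q) : O2Enclosure A Q ∅ :=
  fun X hX hmem => (h X hX hmem).elim

/-- Subsets of an excluded set are excluded. [cite: ChesterEtAl2020, §3.3 (allowed and disallowed points)] -/
theorem mono (h : BoxExcluded A Q) (hQ : Q' ⊆ Q) : BoxExcluded A Q' :=
  fun X hX hmem => h X hX (hQ hmem)

/-- Excluded sets are closed under union. [cite: ChesterEtAl2020, §3.3 (allowed and disallowed points)] -/
theorem union (h : BoxExcluded A Q) (h' : BoxExcluded A Q') : BoxExcluded A (Q ∪ Q') :=
  fun X hX hmem => hmem.elim (h X hX) (h' X hX)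

/-- Monotonicity in the assumptions. [cite: ChesterEtAl2020, §2.2 (assumptions about the spectrum)] -/
theorem of_weaker (h : BoxExcluded A' Q) (hw : A'.Weaker A) : BoxExcluded A Q :=
  fun X hX hmem => h X (hX.of_weaker hw) hmem

end BoxExcluded

/-- **Assembly of a certificate**: if `W ⊆ R ∪ ⋃ᵢ Qᵢ` and every `Qᵢ` is excluded, then `O2Enclosure A W R` —
the island `R` is what is left of the window after the certified boxes are removed.
[cite: ChesterEtAl2020, §3.3 (allowed and disallowed points)] -/
theorem o2Enclosure_of_cover {A : O2Gaps} {ι : Type*} {W R : Set (ℝ × ℝ × ℝ)} (Q : ι → Set (ℝ × ℝ × ℝ))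
    (hcov : W ⊆ R ∪ ⋃ i, Q i) (hQ : ∀ i, BoxExcluded A (Q i)) : O2Enclosure A W R := by
  intro X hX hmem
  rcases hcov hmem with hR | hQ'
  · exact hR
  · obtain ⟨i, hi⟩ := Set.mem_iUnion.mp hQ'
    exact ((hQ i) X hX hi).elim

/-! ## 4. The dual side: positivity obligations and exclusion by point functionals -/

/-- **The functional conditions of §3.1–§3.2 as obligations over the typed axioms.**  `IsPositiveFor α A D l`:
at external dimensions `D`, against the thresholds `A`, with class representative `l` of `[λ_ext]`: the unit
normalisation `(1 1 1) α(V⃗_{0⁺,0,0}) (1;1;1) > 0` (any positive value); the weaker external condition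
`lᵀ α(V⃗_ext) l ≥ 0` for EVERY genuine choice of the block families of the exchanged `s, φ, t`; and, for every
`(Δ, ℓ)` admissible in its sector (`Allows0p … Allows4`) and every genuine block family there,
`α(V⃗_{0⁺}) ⪰ 0`, `α(V⃗_{0⁻}) ⪰ 0`, `α(V⃗_1[(−1)^ℓ]) ⪰ 0`, `α(V⃗_{2⁺}) ⪰ 0`, `α(V⃗_{2⁻}) ≥ 0`, `α(V⃗_3[(−1)^ℓ]) ≥ 0`,
`α(V⃗_4) ≥ 0`. [cite: ChesterEtAl2020, §3.1 (functional conditions), §3.2 (weaker condition)] -/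
def IsPositiveFor (α : (ℝ → ℝ → Fin 22 → ℝ) →ₗ[ℝ] ℝ) (A : O2Gaps) (D : Dims) (l : Fin 4 → ℝ) : Prop :=
  0 < ![(1 : ℝ), 1, 1] ⬝ᵥ (alphaMat α (V0p D unitBlocks) *ᵥ ![(1 : ℝ), 1, 1]) ∧
    (∀ gs gφ gt : Label → ℝ → ℝ → ℝ, GenuineOn D labels0p D.Δs 0 gs → GenuineOn D labels1 D.Δφ 0 gφ →
      GenuineOn D labels2p D.Δt 0 gt → 0 ≤ l ⬝ᵥ (alphaMat α (Vext D gs gφ gt) *ᵥ l)) ∧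
    (∀ (Δ : ℝ) (ℓ : ℕ) (g : Label → ℝ → ℝ → ℝ), A.Allows0p Δ ℓ → GenuineOn D labels0p Δ ℓ g →
      (alphaMat α (V0p D g)).PosSemidef) ∧
    (∀ (Δ : ℝ) (ℓ : ℕ) (g : Label → ℝ → ℝ → ℝ), A.Allows0m Δ ℓ → GenuineOn D labels0m Δ ℓ g →
      (alphaMat α (V0m D g)).PosSemidef) ∧
    (∀ (Δ : ℝ) (ℓ : ℕ) (g : Label → ℝ → ℝ → ℝ), A.Allows1 Δ ℓ → GenuineOn D labels1 Δ ℓ g →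
      (alphaMat α (V1 D ((-1) ^ ℓ) g)).PosSemidef) ∧
    (∀ (Δ : ℝ) (ℓ : ℕ) (g : Label → ℝ → ℝ → ℝ), A.Allows2p Δ ℓ → GenuineOn D labels2p Δ ℓ g →
      (alphaMat α (V2p D g)).PosSemidef) ∧
    (∀ (Δ : ℝ) (ℓ : ℕ) (g : Label → ℝ → ℝ → ℝ), A.Allows2m Δ ℓ → GenuineOn D labels2m Δ ℓ g →
      0 ≤ α (V2m D g)) ∧
    (∀ (Δ : ℝ) (ℓ : ℕ) (g : Label → ℝ → ℝ → ℝ), A.Allows3 Δ ℓ → GenuineOn D labels3 Δ ℓ g →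
      0 ≤ α (V3 D ((-1) ^ ℓ) g)) ∧
      ∀ (Δ : ℝ) (ℓ : ℕ) (g : Label → ℝ → ℝ → ℝ), A.Allows4 Δ ℓ → GenuineOn D labels4 Δ ℓ g →
        0 ≤ α (V4 D g)

/-- The strong external condition `α(V⃗_ext) ⪰ 0` (for all genuine external block families) gives the weaker
one at every class. [cite: ChesterEtAl2020, §3.2 (strong condition `α(V⃗_ext) ⪰ 0`)] -/
theorem extWeak_of_strong (α : (ℝ → ℝ → Fin 22 → ℝ) →ₗ[ℝ] ℝ) (D : Dims)
    (h : ∀ gs gφ gt : Label → ℝ → ℝ → ℝ, GenuineOn D labels0p D.Δs 0 gs → GenuineOn D labels1 D.Δφ 0 gφ →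
      GenuineOn D labels2p D.Δt 0 gt → (alphaMat α (Vext D gs gφ gt)).PosSemidef) (l : Fin 4 → ℝ) :
    ∀ gs gφ gt : Label → ℝ → ℝ → ℝ, GenuineOn D labels0p D.Δs 0 gs → GenuineOn D labels1 D.Δφ 0 gφ →
      GenuineOn D labels2p D.Δt 0 gt → 0 ≤ l ⬝ᵥ (alphaMat α (Vext D gs gφ gt) *ᵥ l) :=
  fun gs gφ gt hs hφ ht => extWeak_of_posSemidef α (h gs gφ gt hs hφ ht) l

/-- Point functionals apply termwise, with the evaluation points indexed: from convergence of a series of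
22-vectors at each point `(u_m, v_m)` to `T m`, the applied series converges to `Σ_m Σ_r w m r · T m r`.
[cite: HogervorstRychkov2013, §4.3] -/
theorem hasSum_pointFunctional₂₂_pts {M : ℕ} (w : Fin M → Fin 22 → ℝ) (u v : Fin M → ℝ) {ι : Type*}
    {f : ι → ℝ → ℝ → Fin 22 → ℝ} {T : Fin M → Fin 22 → ℝ}
    (h : ∀ m, HasSum (fun o => f o (u m) (v m)) (T m)) :
    HasSum (fun o => pointFunctional₂₂ w u v (f o)) (∑ m, ∑ r, w m r * T m r) := by
  simp only [pointFunctional₂₂_apply]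
  refine hasSum_sum fun m _ => hasSum_sum fun r _ => ?_
  exact ((Pi.hasSum.mp (h m)) r).mul_left (w m r)

/-- **Exclusion by point functionals** — *"If `α` exists for all `[λ_ext]`, then the point `(Δ_s, Δ_φ, Δ_t)` is
disallowed"*, for every point of `Q`: if at every `D ∈ Q` and for every class representative `l ≠ 0` some
point functional (weights `w`, evaluation points `(z_m z̄_m, (1−z_m)(1−z̄_m))` with `z_m, z̄_m ∈ (0,1)`)
satisfies `IsPositiveFor _ A D l`, then `BoxExcluded A Q`.  Proof: for a datum `X` with `X.D ∈ Q` take the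
class of its `λ_ext` (`false_of_forall_class`; `λ_ext = 0` is covered by any class), apply the functional
termwise to the seven sector series of A3 at the evaluation points (automatic for point functionals), and
run `false_of_functional₂₂` with the positivity of every term supplied by A1 + A4 (admissibility) and A2
(genuineness). [cite: ChesterEtAl2020, §3.3 (allowed and disallowed points), §3.1 (functional conditions)] -/
theorem boxExcluded_of_pointFunctionals {A : O2Gaps} {Q : Set (ℝ × ℝ × ℝ)}
    (h : ∀ D : Dims, (D.Δs, D.Δφ, D.Δt) ∈ Q → ∀ l : Fin 4 → ℝ, l ≠ 0 →
      ∃ (M : ℕ) (w : Fin M → Fin 22 → ℝ) (z zb : Fin M → ℝ),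
        (∀ m, z m ∈ Ioo (0 : ℝ) 1) ∧ (∀ m, zb m ∈ Ioo (0 : ℝ) 1) ∧
          IsPositiveFor (pointFunctional₂₂ w (fun m => z m * zb m) (fun m => (1 - z m) * (1 - zb m)))
            A D l) :
    BoxExcluded A Q := by
  intro X hX hQ
  obtain ⟨hA2, hA1, hA3, hA4⟩ := hX
  refine false_of_forall_class (P := fun l => ∃ (M : ℕ) (w : Fin M → Fin 22 → ℝ) (z zb : Fin M → ℝ),
    (∀ m, z m ∈ Ioo (0 : ℝ) 1) ∧ (∀ m, zb m ∈ Ioo (0 : ℝ) 1) ∧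
      IsPositiveFor (pointFunctional₂₂ w (fun m => z m * zb m) (fun m => (1 - z m) * (1 - zb m))) A X.D l)
    X.lam (h X.D hQ) ?_
  rintro l c - hlam ⟨M, w, z, zb, hz, hzb, hpos⟩
  obtain ⟨hunit, hext, p0p, p0m, p1, p2p, p2m, p3, p4⟩ := hpos
  obtain ⟨gs_ok, gφ_ok, gt_ok, b0p, b0m, b1, b2p, b2m, b3, b4⟩ := hA2
  -- the crossing equation at the evaluation points, sector sums chosen
  choose T0p T0m T1 T2p T2m T3 T4 hT using fun m => hA3 (z m) (zb m) (hz m) (hzb m)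
  set u : Fin M → ℝ := fun m => z m * zb m with hu
  set v : Fin M → ℝ := fun m => (1 - z m) * (1 - zb m) with hv
  set α := pointFunctional₂₂ w u v with hα
  refine false_of_functional₂₂ α X.D (a0 := X.a0) (b0 := X.b0) (c0 := X.c0) (g0p := X.g0p)
    (b0m := X.b0m) (c0m := X.c0m) (g0m := X.g0m) (x1 := X.x1) (y1 := X.y1)
    (ε1 := fun i => (-1) ^ X.ℓ1 i) (g1 := X.g1) (b2 := X.b2) (z2 := X.z2) (g2p := X.g2p)
    (p2m := fun i => X.lam2m i ^ 2) (g2m := X.g2m) (p3 := fun i => X.lam3 i ^ 2)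
    (ε3 := fun i => (-1) ^ X.ℓ3 i) (g3 := X.g3) (p4 := fun i => X.lam4 i ^ 2) (g4 := X.g4)
    (lam := X.lam) (gs := X.gs) (gφ := X.gφ) (gt := X.gt)
    (A0p := ∑ m, ∑ r, w m r * T0p m r) (A0m := ∑ m, ∑ r, w m r * T0m m r)
    (A1 := ∑ m, ∑ r, w m r * T1 m r) (A2p := ∑ m, ∑ r, w m r * T2p m r)
    (A2m := ∑ m, ∑ r, w m r * T2m m r) (A3 := ∑ m, ∑ r, w m r * T3 m r)
    (A4 := ∑ m, ∑ r, w m r * T4 m r)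
    (fun i => sq_nonneg _) (fun i => sq_nonneg _) (fun i => sq_nonneg _)
    ?_ ?_ ?_ ?_ ?_ ?_ ?_ ?_ hunit (ext_nonneg_of_weak α (hext X.gs X.gφ X.gt gs_ok gφ_ok gt_ok) hlam)
    (fun i => p0p _ _ _ (X.allows0p hA1 hA4 i) (b0p i))
    (fun i => p0m _ _ _ (X.allows0m hA1 hA4 i) (b0m i))
    (fun i => p1 _ _ _ (X.allows1 hA1 hA4 i) (b1 i))
    (fun i => p2p _ _ _ (X.allows2p hA1 hA4 i) (b2p i))
    (fun i => p2m _ _ _ (X.allows2m hA1 hA4 i) (b2m i))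
    (fun i => p3 _ _ _ (X.allows3 hA1 hA4 i) (b3 i))
    (fun i => p4 _ _ _ (X.allows4 hA1 hA4 i) (b4 i))
  · exact hasSum_pointFunctional₂₂_pts w u v
      (f := fun i => quad0p X.D (X.a0 i) (X.b0 i) (X.c0 i) (X.g0p i)) fun m => (hT m).1
  · exact hasSum_pointFunctional₂₂_pts w u v
      (f := fun i => quad0m X.D (X.b0m i) (X.c0m i) (X.g0m i)) fun m => (hT m).2.1
  · exact hasSum_pointFunctional₂₂_pts w u v
      (f := fun i => quad1 X.D (X.x1 i) (X.y1 i) ((-1) ^ X.ℓ1 i) (X.g1 i)) fun m => (hT m).2.2.1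
  · exact hasSum_pointFunctional₂₂_pts w u v
      (f := fun i => quad2p X.D (X.b2 i) (X.z2 i) (X.g2p i)) fun m => (hT m).2.2.2.1
  · have := hasSum_pointFunctional₂₂_pts w u v (f := fun i => X.lam2m i ^ 2 • V2m X.D (X.g2m i))
      (T := T2m) fun m => (hT m).2.2.2.2.1
    simpa [map_smul, smul_eq_mul] using this
  · have := hasSum_pointFunctional₂₂_pts w u v
      (f := fun i => X.lam3 i ^ 2 • V3 X.D ((-1) ^ X.ℓ3 i) (X.g3 i)) (T := T3)
      fun m => (hT m).2.2.2.2.2.1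
    simpa [map_smul, smul_eq_mul] using this
  · have := hasSum_pointFunctional₂₂_pts w u v (f := fun i => X.lam4 i ^ 2 • V4 X.D (X.g4 i))
      (T := T4) fun m => (hT m).2.2.2.2.2.2.1
    simpa [map_smul, smul_eq_mul] using this
  · -- `α` annihilates the crossing equation: it vanishes at every evaluation point
    have key : ∀ m, quad0p X.D 1 1 1 unitBlocks (u m) (v m) +
        quadVext X.D X.lam X.gs X.gφ X.gt (u m) (v m) + T0p m + T0m m + T1 m + T2p m + T2m m + T3 m +
          T4 m = 0 := fun m => (hT m).2.2.2.2.2.2.2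
    have hsum : ∑ m, ∑ r, w m r * (quad0p X.D 1 1 1 unitBlocks (u m) (v m) +
        quadVext X.D X.lam X.gs X.gφ X.gt (u m) (v m) + T0p m + T0m m + T1 m + T2p m + T2m m + T3 m +
          T4 m) r = 0 :=
      Finset.sum_eq_zero fun m _ => Finset.sum_eq_zero fun r _ => by rw [key m, Pi.zero_apply, mul_zero]
    simpa only [hα, pointFunctional₂₂_apply, Pi.add_apply, mul_add, Finset.sum_add_distrib] using hsum

/-- **Exclusion by ONE point functional with the strong external condition** (the "naive" set-up of §3.2,
*"If we know nothing about `λ_ext`"*): positivity with `α(V⃗_ext) ⪰ 0` in place of the class-wise condition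
excludes the point for every `λ_ext`. [cite: ChesterEtAl2020, §3.2 (strong condition `α(V⃗_ext) ⪰ 0`)] -/
theorem boxExcluded_of_pointFunctionals_strong {A : O2Gaps} {Q : Set (ℝ × ℝ × ℝ)}
    (h : ∀ D : Dims, (D.Δs, D.Δφ, D.Δt) ∈ Q →
      ∃ (M : ℕ) (w : Fin M → Fin 22 → ℝ) (z zb : Fin M → ℝ),
        (∀ m, z m ∈ Ioo (0 : ℝ) 1) ∧ (∀ m, zb m ∈ Ioo (0 : ℝ) 1) ∧
          (∀ gs gφ gt : Label → ℝ → ℝ → ℝ, GenuineOn D labels0p D.Δs 0 gs →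
            GenuineOn D labels1 D.Δφ 0 gφ → GenuineOn D labels2p D.Δt 0 gt →
              (alphaMat (pointFunctional₂₂ w (fun m => z m * zb m) (fun m => (1 - z m) * (1 - zb m)))
                (Vext D gs gφ gt)).PosSemidef) ∧
          IsPositiveFor (pointFunctional₂₂ w (fun m => z m * zb m) (fun m => (1 - z m) * (1 - zb m)))
            A D 0) :
    BoxExcluded A Q := by
  refine boxExcluded_of_pointFunctionals fun D hD l _ => ?_
  obtain ⟨M, w, z, zb, hz, hzb, hstrong, hpos⟩ := h D hD
  refine ⟨M, w, z, zb, hz, hzb, hpos.1, extWeak_of_strong _ D hstrong l, hpos.2.2⟩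

end Literature.MathematicalPhysics.QuantumFieldTheory.O2ThreeScalarSystem

end
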